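import Summits.CriticalPhenomena.PercolationContinuityZ3.Theorems.PercNearOneGluingAdditiveGluingAL5Layers
import HarnessLib

/-! # Crux `PercNearOneGluing.AdditiveGluing` (stmt-CriticalPhenomena-4576) — AL5 ladder: the ANCHOR form of the multi-edge Lemma 3

Support file (`--supports stmt-CriticalPhenomena-4576`; task png-dp-al5); no definitions, no named facts.

The landed `multiEdge_lemma3` (p174503) proves `μ(R ∩ {d ↔ b}) ≤ μ(R ∩ {x ↔ b})` (`R` = some edge `x–T` open) from
`τ(d) ≤ τ(a)` for all `a ∈ T`.  Its proof uses the hypothesis only through an ANCHOR vertex `c`, the minimiser of the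
reliability `τ₀` under the weighting with the star `F = {s(x,a) : a ∈ T}` removed:  (i) `τ₀(c) ≤ τ₀(a)` for all `a ∈ T`,
(ii) `τ₀(c) ≤ τ₀(d)`, (iii) `τ(d) ≤ τ(c)`.  This file records the theorem with exactly these three hypotheses
(`multiEdge_lemma3_anchor`), so that it can be applied to weightings in which `τ(d) ≤ τ(a)` is NOT available for every
`a ∈ T` — the glued blocks of the AL5 ladder:

* `al5_of_anchor` — AL5 for EVERY block `S`: `μ_{w^S}(R ∩ {d ↔ b}) ≤ μ_{w^S}(R ∩ {x ↔ b})` as soon as some `c` satisfies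
  (i)–(iii) for the glued weighting `w^S` (this is route "C2" of the task notes: no glued drift of `d` past the anchor);
* `al5_of_min_deleted` — the case `c = d`: if `d` is below `T` under the glued weighting with the star `F` removed, AL5 holds
  with NO hypothesis on the un-glued weighting at all.
[cite: KozmaNitzan2024, Lemma 3(i) (pp. 6–7), Lemma 5 (p. 13)]
-/

namespace Summit.CriticalPhenomena.PercolationContinuityZ3.Theorems

open MeasureTheory Set
open Literature.Probability.LatticeModels (prodBernoulli)
open Literature.Probability.Percolation (BondConfig openConn openGraph openEdgeCluster pinW localCylinder
  DeterminedBy determinedBy_iff)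

noncomputable section
open Classical

section AL5Anchor

open Filter Topology Literature.Probability.LatticeModels Literature.Probability.Percolation

variable {n : ℕ}

/-- **Multi-edge Lemma 3, anchor form.**  Let `x ∉ T`, `F = {s(x,a) : a ∈ T}`, `τ₀` the reliability under the weighting with
`F` removed (`pinW w F ∅`), and `c` a vertex with `τ₀(c) ≤ τ₀(a)` for all `a ∈ T`, `τ₀(c) ≤ τ₀(d)` and `τ(d) ≤ τ(c)`.  Then
`μ(R ∩ {d ↔ b}) ≤ μ(R ∩ {x ↔ b})`, `R` = some edge of `F` open.  (Proof of `multiEdge_lemma3` verbatim, the minimiser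
replaced by the given anchor.) [cite: KozmaNitzan2024, Lemma 3(i) (pp. 6–7), Lemma 5 (p. 13)] -/
theorem multiEdge_lemma3_anchor (w : Sym2 (Fin n) → unitInterval) (x d b c : Fin n) (T : Finset (Fin n))
    (hxT : x ∉ T)
    (hc0 : ∀ a ∈ T,
      (prodBernoulli (pinW w (↑(T.image fun a => s(x, a)) : Set (Sym2 (Fin n))) ↑(∅ : Finset (Sym2 (Fin n))))).real
          (openConn c b) ≤
        (prodBernoulli (pinW w (↑(T.image fun a => s(x, a)) : Set (Sym2 (Fin n))) ↑(∅ : Finset (Sym2 (Fin n))))).real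
          (openConn a b))
    (hcd0 :
      (prodBernoulli (pinW w (↑(T.image fun a => s(x, a)) : Set (Sym2 (Fin n))) ↑(∅ : Finset (Sym2 (Fin n))))).real
          (openConn c b) ≤
        (prodBernoulli (pinW w (↑(T.image fun a => s(x, a)) : Set (Sym2 (Fin n))) ↑(∅ : Finset (Sym2 (Fin n))))).real
          (openConn d b))
    (hdc : (prodBernoulli w).real (openConn d b) ≤ (prodBernoulli w).real (openConn c b)) :
    (prodBernoulli w).real ({ω : Set (Sym2 (Fin n)) | ∃ a ∈ T, s(x, a) ∈ ω} ∩ openConn d b) ≤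
      (prodBernoulli w).real ({ω : Set (Sym2 (Fin n)) | ∃ a ∈ T, s(x, a) ∈ ω} ∩ openConn x b) := by
  set F : Finset (Sym2 (Fin n)) := T.image (fun a => s(x, a)) with hFdef
  have hF : ∀ e ∈ F, ∃ a, a ≠ x ∧ e = s(x, a) := by
    intro e he
    obtain ⟨a, haT, rfl⟩ := Finset.mem_image.1 he
    exact ⟨a, fun h => hxT (h ▸ haT), rfl⟩
  have hR : {ω : Set (Sym2 (Fin n)) | ∃ a ∈ T, s(x, a) ∈ ω} = {ω | ∃ e ∈ F, e ∈ ω} := by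
    ext ω
    simp only [Set.mem_setOf_eq, hFdef, Finset.mem_image]
    constructor
    · rintro ⟨a, haT, ha⟩; exact ⟨s(x, a), ⟨a, haT, rfl⟩, ha⟩
    · rintro ⟨e, ⟨a, haT, rfl⟩, he⟩; exact ⟨a, haT, he⟩
  rw [hR]
  set R : Set (Set (Sym2 (Fin n))) := {ω | ∃ e ∈ F, e ∈ ω} with hRdef
  set w₀ : Sym2 (Fin n) → unitInterval := pinW w ↑F ↑(∅ : Finset (Sym2 (Fin n))) with hw₀
  set τ₀ : Fin n → ℝ := fun v => (prodBernoulli w₀).real (openConn v b) with hτ₀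
  have hcT : ∀ a ∈ T, τ₀ c ≤ τ₀ a := hc0
  have hcd : τ₀ c ≤ τ₀ d := hcd0
  -- (i) CORE on every pattern meeting `R`
  have hcore : ∀ J : Finset (Sym2 (Fin n)), J ⊆ F → (↑J : Set (Sym2 (Fin n))) ∈ R →
      (prodBernoulli (pinW w ↑F ↑J)).real (openConn c b) ≤
        (prodBernoulli (pinW w ↑F ↑J)).real (openConn x b) := by
    intro J hJF hJR
    obtain ⟨e, heF, heJ⟩ := hJR
    have heJ' : e ∈ J := Finset.mem_coe.1 heJ
    obtain ⟨a, hax, rfl⟩ := hF e heF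
    have haT : a ∈ T := by
      obtain ⟨a', ha'T, he'⟩ := Finset.mem_image.1 heF
      rcases Sym2.eq_iff.1 he' with ⟨-, h⟩ | ⟨h, -⟩
      · exact h ▸ ha'T
      · exact (hax h.symm).elim
    exact multiEdge_core w hF hJF heJ' hax c b (hcT a haT)
  -- law of total probability over the patterns of `F`, for `R` and for `Rᶜ`
  have hRm : MeasurableSet R := MeasurableSet.of_discrete
  have hdec := fun v : Fin n =>
    prodBernoulli_real_inter_eq_sum_pinW w F (A := openConn v b) (B := R) MeasurableSet.of_discrete
      (DepthOneGluing.determinedBy_exists_mem F)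
  have hdecC := fun v : Fin n =>
    prodBernoulli_real_inter_eq_sum_pinW w F (A := openConn v b) (B := Rᶜ) MeasurableSet.of_discrete
      (determinedBy_forall_not_mem F)
  have hN : ∀ v : Fin n, (prodBernoulli w).real (openConn v b ∩ Rᶜ) =
      (prodBernoulli w).real (localCylinder ↑F ↑(∅ : Finset (Sym2 (Fin n)))) * τ₀ v := by
    intro v
    rw [hdecC v]
    refine Finset.sum_eq_single_of_mem ∅ ?_ ?_
    · refine (@Finset.mem_filter _ _ (_) _ _).2 ⟨Finset.mem_powerset.2 (Finset.empty_subset F), ?_⟩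
      rintro ⟨e, -, he⟩
      exact Finset.notMem_empty e (Finset.mem_coe.1 he)
    · intro J hJ hne
      exfalso
      obtain ⟨hJF, hno⟩ := (@Finset.mem_filter _ _ (_) _ _).1 hJ
      obtain ⟨e, heJ⟩ := Finset.nonempty_iff_ne_empty.2 hne
      exact hno ⟨e, Finset.mem_powerset.1 hJF heJ, Finset.mem_coe.2 heJ⟩
  have hsplit : ∀ v : Fin n, (prodBernoulli w).real (openConn v b ∩ R) +
      (prodBernoulli w).real (openConn v b ∩ Rᶜ) = (prodBernoulli w).real (openConn v b) :=
    fun v => measureReal_inter_add_sdiff (μ := prodBernoulli w) (s := openConn v b) hRm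
  -- (ii) `μ(c↔b, R) ≤ μ(x↔b, R)` termwise
  have hcx : (prodBernoulli w).real (openConn c b ∩ R) ≤ (prodBernoulli w).real (openConn x b ∩ R) := by
    rw [hdec c, hdec x]
    refine Finset.sum_le_sum fun J hJ => mul_le_mul_of_nonneg_left ?_ measureReal_nonneg
    obtain ⟨hJF, hJR⟩ := (@Finset.mem_filter _ _ (_) _ _).1 hJ
    exact hcore J (Finset.mem_powerset.1 hJF) hJR
  -- (iii) `μ(d↔b, R) ≤ μ(c↔b, R)` from `τ(d) ≤ τ(c)` and `τ₀(c) ≤ τ₀(d)`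
  have hdc' : (prodBernoulli w).real (openConn d b ∩ R) ≤ (prodBernoulli w).real (openConn c b ∩ R) := by
    have hd := hsplit d
    have hc' := hsplit c
    rw [hN] at hd hc'
    have hmono : (prodBernoulli w).real (localCylinder ↑F ↑(∅ : Finset (Sym2 (Fin n)))) * τ₀ c ≤
        (prodBernoulli w).real (localCylinder ↑F ↑(∅ : Finset (Sym2 (Fin n)))) * τ₀ d :=
      mul_le_mul_of_nonneg_left hcd measureReal_nonneg
    linarith
  rw [Set.inter_comm R (openConn d b), Set.inter_comm R (openConn x b)]
  exact hdc'.trans hcx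

/-- **AL5 for every block from an anchor in the glued weighting** (route C2).  With `w^S` the glued block (star `x–S`
forced open), `F = {s(x,a) : a ∈ T}` and `(w^S)₀` the glued weighting with `F` removed: if some `c` has
`τ_{(w^S)₀}(c) ≤ τ_{(w^S)₀}(a)` for all `a ∈ T`, `τ_{(w^S)₀}(c) ≤ τ_{(w^S)₀}(d)` and `τ_{w^S}(d) ≤ τ_{w^S}(c)`, then
`μ_{w^S}(R ∩ {d ↔ b}) ≤ μ_{w^S}(R ∩ {x ↔ b})`.  In particular AL5 holds whenever the glued minimiser `d` has not drifted past
the `F`-deleted minimiser of `T`. [cite: KozmaNitzan2024, Lemma 3(i) (pp. 6–7), Lemma 5 (p. 13)] -/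
theorem al5_of_anchor (w : Sym2 (Fin n) → unitInterval) (S T : Finset (Fin n)) (x d b c : Fin n) (hxT : x ∉ T)
    (hc0 : ∀ a ∈ T,
      (prodBernoulli (pinW (fun e : Sym2 (Fin n) => if e ∈ S.image (fun y => s(x, y)) then 1 else w e)
          (↑(T.image fun a => s(x, a)) : Set (Sym2 (Fin n))) ↑(∅ : Finset (Sym2 (Fin n))))).real (openConn c b) ≤
        (prodBernoulli (pinW (fun e : Sym2 (Fin n) => if e ∈ S.image (fun y => s(x, y)) then 1 else w e)
          (↑(T.image fun a => s(x, a)) : Set (Sym2 (Fin n))) ↑(∅ : Finset (Sym2 (Fin n))))).real (openConn a b))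
    (hcd0 :
      (prodBernoulli (pinW (fun e : Sym2 (Fin n) => if e ∈ S.image (fun y => s(x, y)) then 1 else w e)
          (↑(T.image fun a => s(x, a)) : Set (Sym2 (Fin n))) ↑(∅ : Finset (Sym2 (Fin n))))).real (openConn c b) ≤
        (prodBernoulli (pinW (fun e : Sym2 (Fin n) => if e ∈ S.image (fun y => s(x, y)) then 1 else w e)
          (↑(T.image fun a => s(x, a)) : Set (Sym2 (Fin n))) ↑(∅ : Finset (Sym2 (Fin n))))).real (openConn d b))
    (hdc : (prodBernoulli (fun e : Sym2 (Fin n) => if e ∈ S.image (fun y => s(x, y)) then 1 else w e)).real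
        (openConn d b) ≤
      (prodBernoulli (fun e : Sym2 (Fin n) => if e ∈ S.image (fun y => s(x, y)) then 1 else w e)).real
        (openConn c b)) :
    (prodBernoulli (fun e : Sym2 (Fin n) => if e ∈ S.image (fun y => s(x, y)) then 1 else w e)).real
        ({ω : Set (Sym2 (Fin n)) | ∃ a ∈ T, s(x, a) ∈ ω} ∩ openConn d b) ≤
      (prodBernoulli (fun e : Sym2 (Fin n) => if e ∈ S.image (fun y => s(x, y)) then 1 else w e)).real
        ({ω : Set (Sym2 (Fin n)) | ∃ a ∈ T, s(x, a) ∈ ω} ∩ openConn x b) :=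
  multiEdge_lemma3_anchor _ x d b c T hxT hc0 hcd0 hdc

/-- **AL5 for every block when `d` is minimal after deleting the relay star** (the case `c = d` of `al5_of_anchor`): if
`τ_{(w^S)₀}(d) ≤ τ_{(w^S)₀}(a)` for all `a ∈ T` (`(w^S)₀` = glued block, star `F` removed), then
`μ_{w^S}(R ∩ {d ↔ b}) ≤ μ_{w^S}(R ∩ {x ↔ b})` — no hypothesis on the un-glued weighting is needed.
[cite: KozmaNitzan2024, Lemma 5 (p. 13)] -/
theorem al5_of_min_deleted (w : Sym2 (Fin n) → unitInterval) (S T : Finset (Fin n)) (x d b : Fin n) (hxT : x ∉ T)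
    (hd0 : ∀ a ∈ T,
      (prodBernoulli (pinW (fun e : Sym2 (Fin n) => if e ∈ S.image (fun y => s(x, y)) then 1 else w e)
          (↑(T.image fun a => s(x, a)) : Set (Sym2 (Fin n))) ↑(∅ : Finset (Sym2 (Fin n))))).real (openConn d b) ≤
        (prodBernoulli (pinW (fun e : Sym2 (Fin n) => if e ∈ S.image (fun y => s(x, y)) then 1 else w e)
          (↑(T.image fun a => s(x, a)) : Set (Sym2 (Fin n))) ↑(∅ : Finset (Sym2 (Fin n))))).real (openConn a b)) :
    (prodBernoulli (fun e : Sym2 (Fin n) => if e ∈ S.image (fun y => s(x, y)) then 1 else w e)).real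
        ({ω : Set (Sym2 (Fin n)) | ∃ a ∈ T, s(x, a) ∈ ω} ∩ openConn d b) ≤
      (prodBernoulli (fun e : Sym2 (Fin n) => if e ∈ S.image (fun y => s(x, y)) then 1 else w e)).real
        ({ω : Set (Sym2 (Fin n)) | ∃ a ∈ T, s(x, a) ∈ ω} ∩ openConn x b) :=
  al5_of_anchor w S T x d b d hxT hd0 le_rfl le_rfl

end AL5Anchor

end

end Summit.CriticalPhenomena.PercolationContinuityZ3.Theorems
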